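import Mathlib
import Literature.RingTheory.CohomologyAnnihilator.HomBaseChangeFlat
import HarnessLib

/-!
# Duals and double duals commute with flat base change (finitely presented / noetherian case)

Topic: `Literature/RingTheory/CohomologyAnnihilator`.  Corollaries of `isBaseChange_baseChangeHom`
([Matsumura1987, Thm. 7.11]: `S ⊗_R Hom_R(M, N) ≅ Hom_S(S ⊗ M, S ⊗ N)` for `S` flat, `M` finitely presented):

* `isBaseChange_dual_baseChange` — `Module.Dual.baseChange S : M* → (S ⊗ M)*` is a base change:
  `S ⊗_R M* ≅ (S ⊗_R M)*` (`M` finitely presented, `S` flat);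
* `isBaseChange_comp_linearEquiv` — bookkeeping: a base change followed by an `S`-linear isomorphism is a base change;
* `finite_dual_of_isNoetherianRing` — `M*` is finitely generated for `M` finitely generated over a noetherian ring;
* `isBaseChange_bidual` — over a noetherian `R`, for `M` finitely generated: `S ⊗_R M** ≅ (S ⊗_R M)**`, as the base
  change property of `M** → (S ⊗ M*)* ≅ (S ⊗ M)**` (the second map is the transpose of the inverse of the first
  isomorphism).

Recorded for the level-exact completion transport of the cohomology annihilator (route
`ResolutionOfSingularities/HomologicalConductor`, rung S-2, toric class): reflexive hulls of punctured-free retracts.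

References: H. Matsumura, *Commutative Ring Theory*, Thm. 7.11 [`Matsumura1987`]; W. Bruns, J. Herzog,
*Cohen–Macaulay rings*, proof of Prop. 1.4.1 (duals under flat base change).
-/

noncomputable section

open TensorProduct LinearMap Function

universe u

namespace Literature.RingTheory.CohomologyAnnihilator

variable {R : Type u} [CommRing R] (S : Type u) [CommRing S] [Algebra R S]
variable {M : Type u} [AddCommGroup M] [Module R M]

/-- **A base change followed by an `S`-linear isomorphism is a base change.** [cite: Matsumura1987, Thm. 7.11 (proof, bookkeeping)] -/
theorem isBaseChange_comp_linearEquiv {V : Type u} [AddCommGroup V] [Module R V] {W W' : Type u} [AddCommGroup W]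
    [Module R W] [Module S W] [IsScalarTower R S W] [AddCommGroup W'] [Module R W'] [Module S W']
    [IsScalarTower R S W'] {f : V →ₗ[R] W} (h : IsBaseChange S f) (e : W ≃ₗ[S] W') :
    IsBaseChange S ((e.toLinearMap.restrictScalars R) ∘ₗ f) :=
  IsBaseChange.of_equiv (h.equiv.trans e) fun v => by
    rw [LinearEquiv.trans_apply, IsBaseChange.equiv_tmul, one_smul]; rfl

/-- **The dual commutes with flat base change for finitely presented modules**: `f ↦ (s ⊗ m ↦ f(m)·s)`,
`M* → (S ⊗_R M)*` (`Module.Dual.baseChange`), is a base change along `R → S`, i.e. `S ⊗_R M* ≅ (S ⊗_R M)*`, for `S`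
flat over `R` and `M` finitely presented. [cite: Matsumura1987, Thm. 7.11] -/
theorem isBaseChange_dual_baseChange [Module.Flat R S] [Module.FinitePresentation R M] :
    IsBaseChange S (Module.Dual.baseChange S : Module.Dual R M →ₗ[R] Module.Dual S (S ⊗[R] M)) := by
  refine IsBaseChange.of_equiv
    ((LinearEquiv.ofBijective _ (bijective_liftBaseChange_baseChangeHom S (M := M) (N := R))).trans
      (LinearEquiv.congrRight (AlgebraTensorModule.rid R S S))) fun f => ?_
  apply LinearMap.ext
  intro x
  change (AlgebraTensorModule.rid R S S)
      ((((LinearMap.baseChangeHom R S M R).liftBaseChange S) ((1 : S) ⊗ₜ[R] f)) x) = Module.Dual.baseChange S f x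
  rw [liftBaseChange_baseChangeHom_tmul, one_smul]
  induction x using TensorProduct.induction_on with
  | zero => simp
  | tmul s m =>
    rw [LinearMap.baseChange_tmul, AlgebraTensorModule.rid_tmul, Module.Dual.baseChange_apply_tmul]
  | add x y hx hy => rw [map_add, map_add, map_add, hx, hy]

/-- The dual of a finitely generated module over a noetherian ring is finitely generated (`N* ↪ (Rⁿ)*`).
[cite: Matsumura1987, Thm. 7.11 (proof, bookkeeping)] -/
theorem finite_dual_of_isNoetherianRing [IsNoetherianRing R] [Module.Finite R M] :
    Module.Finite R (Module.Dual R M) := by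
  obtain ⟨n, π, hπ⟩ := Module.Finite.exists_fin' R M
  exact Module.Finite.of_injective π.dualMap (LinearMap.dualMap_injective_of_surjective hπ)

set_option maxHeartbeats 800000 in
/-- **The double dual commutes with flat base change** (noetherian `R`, finitely generated `M`, flat `S`): the map
`M** → (S ⊗ M*)* → (S ⊗ M)**` — `Module.Dual.baseChange` for `M*` (finitely presented, `R` noetherian) followed by the
transpose (`LinearEquiv.dualMap`) of the inverse of `S ⊗ M* ≅ (S ⊗ M)*` — is a base change along `R → S`:
`S ⊗_R M** ≅ (S ⊗_R M)**`.  (Heartbeat budget raised: the statement's instance paths on iterated duals are slow to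
unify.) [cite: Matsumura1987, Thm. 7.11 (corollary)] -/
theorem isBaseChange_bidual [IsNoetherianRing R] [Module.Flat R S] [Module.FinitePresentation R M] :
    IsBaseChange S
      (((isBaseChange_dual_baseChange S (M := M)).equiv.symm.dualMap.toLinearMap.restrictScalars R) ∘ₗ
        (Module.Dual.baseChange S : Module.Dual R (Module.Dual R M) →ₗ[R] Module.Dual S (S ⊗[R] Module.Dual R M))) := by
  haveI : Module.Finite R (Module.Dual R M) := finite_dual_of_isNoetherianRing (R := R) (M := M)
  haveI : Module.FinitePresentation R (Module.Dual R M) := Module.finitePresentation_of_finite R (Module.Dual R M)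
  exact isBaseChange_comp_linearEquiv S (isBaseChange_dual_baseChange S (M := Module.Dual R M))
    (isBaseChange_dual_baseChange S (M := M)).equiv.symm.dualMap

end Literature.RingTheory.CohomologyAnnihilator

end
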